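import Summits.KontsevichZagierPeriods.KontsevichZagierPeriods.Theses.PeriodConductors

/-!
# `RamifiedReduction` (stmt-KontsevichZagierPeriods-8407, route PeriodConductors, crux rank 9) — birth skeleton

Crux (the route's declared COMPLEMENT of its unramified linear sector; auto-promoted to crux
2026-08-16 because it is conjecture-grade):
`RamifiedReduction := ∀ c : KZ.FormalRep, KZ.eval c = 0 → ∃ c' ∈ AddSubgroup.closure (cell ∅),
KZ.eval c' = 0 ∧ c - c' ∈ KZ.relations` — every vanishing formal combination of integral
representations is KZ-congruent to a VANISHING `ℤ`-combination of EVERYWHERE-GOOD LINEAR CELLS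
(`cell ∅`: representations `[{ℓ_i > 0 (i ∈ w)}, P(x)/∏ ℓ_i(x)^{m_i}]` over an open rational linear
cell with integral affine forms `ℓ_i`, one row the hyperplane at infinity `ℓ = 1`, whose integer
row family has the same ranks over every `𝔽_p` as over `ℚ` — "conductor `∅`", regular matroid).
With the route's other core `UnimodularKernel` it gives Conjecture 1 (`PeriodConductors.closes`);
conversely Conjecture 1 (kernel form) gives it with `c' = 0`. Summit-strength by design
("owned by all routes", route header RANKED CRUXES #9).

Line (two registered stubs; the conjecture-grade content is carried by a stub SHARED with an
existing item, the route-specific content by a theorem-grade stub):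

* `stub_residualBeyondGenusZero` (S1, THE RESIDUAL; conjecture-grade = the content of the crux,
  SHARED verbatim with item stmt-KontsevichZagierPeriods-3917
  `LinRedNormalForm.ResidualBeyondGenusZero`, the declared residual of route LinRedNormalForm):
  every vanishing formal combination is congruent modulo `KZ.relations` to a `ℤ`-combination of
  GENUS-ZERO representations `[Δ_k, P(t)/(∏ tᵢ^{bᵢ} ∏ (1−tᵢ)^{cᵢ} ∏_{i<j} (tᵢ−tⱼ)^{aᵢⱼ})]`
  (open ordered simplex `1 > t₀ > … > t_{k−1} > 0`, regular top forms on `M_{0,k+3}`).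
  Known bounds (tree, `Theorems/LinRedNormalFormResidualBeyondGenusZeroStrength.lean`):
  `KZKernelConjecture → S1` (`residualBeyondGenusZero_of_kzKernelConjecture`),
  `KontsevichZagierPeriods → S1` (`residualBeyondGenusZero_of_kontsevichZagierPeriods`); the
  converse only granted LinRedNormalForm's sector cruxes. One proof closes S1 here and item 3917.
* `stub_genusZeroCellRegular` (S2, THE SECTOR INCLUSION; theorem-grade, M/L, transcendence-free —
  the PeriodConductors-specific content "the genus-zero (MZV) cells are everywhere good", asserted
  informally throughout the route header: "ζ(2)-cell regular ✓", "the family contains … all MZV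
  cells", EulerBasel's "the ζ(2) simplex is everywhere good (M_{0,5} arrangement)"): every
  absolutely convergent genus-zero representation `r` IS an everywhere-good linear-cell
  representation — its domain is the open integral linear cell cut out by the rows `tᵢ`, `1 − tᵢ`,
  `tᵢ − tⱼ`, its integrand is `P/∏ ℓ_row^{m_row}` on the domain, the row family contains the
  hyperplane at infinity `(1 | 0)`, and for EVERY prime `q` and every row subset the rank over
  `𝔽_q` equals the rank over `ℚ`. Paper proof: homogenised, the rows are `e₀` (infinity),
  `e_{i+1}` (`tᵢ`), `e₀ − e_{i+1}` (`1 − tᵢ`), `e_{i+1} − e_{j+1}` (`tᵢ − tⱼ`): signed incidence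
  vectors of a graph on `{0,…,k} ∪ {apex}` with the apex column deleted (a network matrix, totally
  unimodular); the rank of any set of such rows over ANY field is `Σ_components (#vertices − 1)`,
  hence field-independent. [Oxley, Matroid Theory (2011), Prop. 5.1.2–5.1.3, Thm. 6.6.3 / 13.1;
  Schrijver, Theory of Linear and Integer Programming (1986), §19.3 Ex. 2 (network matrices are TU)]

Composition `ramifiedReduction_of_stubs : S1-sig → S2-sig → RamifiedReduction` (hypotheses form, a
sorry-free `def`; the registered `theorem RamifiedReduction_of : RamifiedReduction` feeds the two stubs
in by name): given `KZ.eval c = 0`, S1 gives `c₀ ∈ closure GZ` with `c − c₀ ∈ relations`; S2 gives `GZ ⊆ cell ∅`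
generator-wise (`gzSet_subset_cell`), so `c₀ ∈ closure (cell ∅)` (`AddSubgroup.closure_mono`);
SOUNDNESS of the calculus (`KZ.relations_le_ker_eval_holds`, a tree theorem) gives
`eval c₀ = eval c = 0`; hence `c' := c₀` witnesses the crux. The crux's `let`-bound sector
vocabulary (`lin`, `good`, `cell`) is re-declared here as definitions (`lin`, `cell` — `good`
inlined into `cell`) and identified with the crux by `ramifiedReduction_iff` (`Iff.rfl`).

Why this cut. `RamifiedReduction` is a RESIDUAL statement ("reach sector Σ modulo relations") for
Σ = everywhere-good linear cells; residual statements are ANTITONE in the sector, and the tree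
already holds a curated residual for the SMALLER sector of genus-zero cells (item 3917, with its
strength file, its splice glue `residualBeyondGenusZero_of_splice`, and its `Negative/` certificates
that rules (1), (2), (3) are each load-bearing). So the crux factors as (3917's residual) ∘ (sector
inclusion GZ ⊆ cell ∅), and the only NEW mathematics a proof of the crux along this line owes beyond
item 3917 is S2 — a finite, checkable statement about the braid arrangement's matroid over `ℤ`.
No new summit-strength statement is minted. (Alternative cut, NOT registered here, recorded in
`Lines/birth.md`: prime-by-prime CONDUCTOR DESCENT inside the linear sector — "a vanishing
combination of linear cells of conductor `insert p S` is congruent to a vanishing combination of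
conductor `S`" + "every vanishing combination reaches the linear sector with some finite
conductor", assembled by induction on `S`; both pieces would be new conjecture-grade statements.)

Disproof used: none on file for THIS crux — `ledger crux ls stmt-KontsevichZagierPeriods-8407`:
no workfiles before this one (no `Disproof.lean`, no ideas, no dead lines). Inherited through S1
(= item 3917): `Cruxes/ResidualBeyondGenusZero/Disproof.lean` records NO KILL; its certified
obstructions `residual_false_without_newtonLeibniz`, `residual_false_without_additivity`,
`residual_false_without_changeOfVariables` (landed under
`Theorems/ResidualBeyondGenusZero/Negative/`) say any proof of S1 must use all of rules (1), (2),
(3) — honoured trivially: S1 is stated over the full `KZ.relations`, and S2 does not touch the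
rules; its refuted strengthenings ("on the nose" `c ∈ closure GZ`, uniqueness of the normal form)
are not assumed anywhere here. `ledger negatives --problem KontsevichZagierPeriods`: one unrelated
entry (KinematicFormulas, plane convexity). All statements are over existing declarations only
(Mathlib + `Literature.NumberTheory.Transcendental.KZCalculus` + the route file).
-/

noncomputable section

set_option linter.dupNamespace false

namespace Summit.KontsevichZagierPeriods.KontsevichZagierPeriods.Cruxes.RamifiedReduction.Birth

open scoped BigOperators Classical Matrix
open Set MeasureTheory
open Literature.NumberTheory.Transcendental
open Summit.KontsevichZagierPeriods.KontsevichZagierPeriods.Theses.PeriodConductors (RamifiedReduction)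

/-! ## The crux's sector vocabulary, as definitions (verbatim the `let`-bodies of the route decls) -/

/-- The integral affine form of row `i` of `M`: `ℓ_i(x) = M i 0 + Σ_j M i (j+1) · x_j`
(column `0` is the constant term — the hyperplane at infinity is the row `(1 | 0)`).
[Kontsevich–Zagier 2001, §1.1; route PeriodConductors, Thesis] -/
def lin (n k : ℕ) (M : Fin k → Fin (n + 1) → ℤ) (i : Fin k) (x : Fin n → ℝ) : ℝ :=
  (M i 0 : ℝ) + ∑ j : Fin n, (M i j.succ : ℝ) * x j

/-- The linear-cell representations of conductor `⊆ S`: classes `[r]` of representations over an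
open integral linear cell `{x | ℓ_i(x) > 0 for the wall rows i ∈ w}` with integrand
`P(x)/∏_i ℓ_i(x)^{m_i}` on the cell, the row family `M` containing the hyperplane at infinity and
having GOOD REDUCTION at every prime `p` outside `S`: every set `T` of rows has the same rank over
`ZMod p` as over `ℚ` (the matroid of the arrangement, hyperplane at infinity included, is unchanged
mod `p`; this is the route's `let good`, inlined). `cell ∅` is the route's everywhere-good
(regular-matroid, "unramified") linear sector. [route PeriodConductors, Thesis; Oxley 2011, §6.6] -/
def cell (S : Finset ℕ) : Set KZ.FormalRep :=
  {x | ∃ (n k : ℕ) (M : Fin k → Fin (n + 1) → ℤ) (w : Fin k → Bool) (m : Fin k → ℕ) (P : MvPolynomial (Fin n) ℚ) (r : KZ.IntegralRep n), (∃ i, M i = Pi.single 0 1) ∧ (∀ p : ℕ, p.Prime → p ∉ S → ∀ T : Finset (Fin k), (Matrix.of fun (i : T) (j : Fin (n + 1)) => (M i j : ZMod p)).rank = (Matrix.of fun (i : T) (j : Fin (n + 1)) => (M i j : ℚ)).rank) ∧ r.domain = {x | ∀ i, w i = true → 0 < lin n k M i x} ∧ Set.EqOn r.integrand (fun x => MvPolynomial.aeval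 x P / ∏ i, lin n k M i x ^ m i) r.domain ∧ x = KZ.of r}

/-- The crux, read through the definitions above (definitional unfolding of its three `let`s).
[route PeriodConductors, item RamifiedReduction] -/
theorem ramifiedReduction_iff :
    RamifiedReduction ↔
      ∀ c : KZ.FormalRep, KZ.eval c = 0 →
        ∃ c' ∈ AddSubgroup.closure (cell ∅), KZ.eval c' = 0 ∧ c - c' ∈ KZ.relations :=
  Iff.rfl

/-- The genus-zero generator set `GZ` — classes of absolutely convergent representations on the
open ordered simplex `{1 > t₀ > … > t_{k−1} > 0}` with integrand
`P(t)/(∏ tᵢ^{bᵢ} ∏ (1−tᵢ)^{cᵢ} ∏_{i<j} (tᵢ−tⱼ)^{aᵢⱼ})` — verbatim the generator set of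
`LinRedNormalForm.ResidualBeyondGenusZero` (stmt-KontsevichZagierPeriods-3917).
[Brown, Ann. Sci. ÉNS 42 (2009), §1; route LinRedNormalForm] -/
def gzSet : Set KZ.FormalRep :=
  {x : KZ.FormalRep | ∃ (k : ℕ) (r : KZ.IntegralRep k) (p : MvPolynomial (Fin k) ℚ) (a : Fin k → Fin k → ℕ) (b c : Fin k → ℕ), r.domain = {t | (∀ i, 0 < t i) ∧ (∀ i, t i < 1) ∧ StrictAnti t} ∧ Set.EqOn r.integrand (fun t => MvPolynomial.aeval t p / ((∏ i, t i ^ b i) * (∏ i, (1 - t i) ^ c i) * ∏ i, ∏ j, if i < j then (t i - t j) ^ a i j else 1)) r.domain ∧ x = KZ.of r}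

/-! ## The two registered stubs -/

/-- **S1 — the residual beyond genus zero (SHARED verbatim with item stmt-KontsevichZagierPeriods-3917
`LinRedNormalForm.ResidualBeyondGenusZero`).** Every vanishing formal combination of integral
representations is congruent modulo `KZ.relations` to a `ℤ`-combination of genus-zero
representations. OPEN, period-conjecture strength (implied by the summit:
`residualBeyondGenusZero_of_kontsevichZagierPeriods`; converse only granted the genus-zero sector
cruxes): this is where the crux's conjecture-grade content lives.
[Kontsevich–Zagier 2001, §1.2 Conj. 1; Huber–Müller-Stach 2017, Conj. 13.2.1; Brown 2009, Thm. 1.1] -/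
theorem stub_residualBeyondGenusZero :
    ∀ c : Literature.NumberTheory.Transcendental.KZ.FormalRep, Literature.NumberTheory.Transcendental.KZ.eval c = 0 → ∃ c₀ ∈ AddSubgroup.closure {x : Literature.NumberTheory.Transcendental.KZ.FormalRep | ∃ (k : ℕ) (r : Literature.NumberTheory.Transcendental.KZ.IntegralRep k) (p : MvPolynomial (Fin k) ℚ) (a : Fin k → Fin k → ℕ) (b c : Fin k → ℕ), r.domain = {t | (∀ i, 0 < t i) ∧ (∀ i, t i < 1) ∧ StrictAnti t} ∧ Set.EqOn r.integrand (fun t => MvPolynomial.aeval t p / ((∏ i, t i ^ b i) * (∏ i, (1 - t i) ^ c i) * ∏ i, ∏ j, if i < j then (t i - t j) ^ a i j else 1)) r.domain ∧ x = Literature.NumberTheory.Transcendental.KZ.of r}, c - c₀ ∈ Literature.NumberTheory.Transcendental.KZ.relations := by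
  sorry

/-- **S2 — genus-zero cells are everywhere-good linear cells (theorem-grade, transcendence-free).**
For every absolutely convergent genus-zero representation `r` (binders verbatim those of `GZ`)
there is an integer row family `M` (with a row `(1 | 0)`, the hyperplane at infinity), wall flags
`w`, exponents `m` and a numerator `P` such that: for EVERY prime `q` every set of rows has the same
rank over `ZMod q` as over `ℚ`; `r.domain` is the open cell `{x | ℓ_i(x) > 0, i ∈ w}`; and
`r.integrand = P/∏_i ℓ_i^{m_i}` on the domain. Intended witness: rows `tᵢ`, `1 − tᵢ`,
`tᵢ − tⱼ`, `1`; homogenised these are `e_{i+1}`, `e₀ − e_{i+1}`, `e_{i+1} − e_{j+1}`, `e₀` —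
incidence vectors of a graph with the apex column deleted (network matrix, totally unimodular), so
every row set has field-independent rank `Σ_components (#vertices − 1)`.
[Oxley 2011, Prop. 5.1.2, Thm. 6.6.3; Schrijver 1986, §19.3; route PeriodConductors, header
"ζ(2)-cell regular", "all MZV cells" are 2-good] -/
theorem stub_genusZeroCellRegular :
    ∀ (k : ℕ) (r : KZ.IntegralRep k) (p : MvPolynomial (Fin k) ℚ) (a : Fin k → Fin k → ℕ) (b c : Fin k → ℕ),
      r.domain = {t | (∀ i, 0 < t i) ∧ (∀ i, t i < 1) ∧ StrictAnti t} →
      Set.EqOn r.integrand (fun t => MvPolynomial.aeval t p / ((∏ i, t i ^ b i) * (∏ i, (1 - t i) ^ c i) * ∏ i, ∏ j, if i < j then (t i - t j) ^ a i j else 1)) r.domain →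
      ∃ (K : ℕ) (M : Fin K → Fin (k + 1) → ℤ) (w : Fin K → Bool) (m : Fin K → ℕ) (P : MvPolynomial (Fin k) ℚ),
        (∃ i, M i = Pi.single 0 1) ∧
        (∀ q : ℕ, q.Prime → ∀ T : Finset (Fin K),
          (Matrix.of fun (i : T) (j : Fin (k + 1)) => (M i j : ZMod q)).rank =
            (Matrix.of fun (i : T) (j : Fin (k + 1)) => (M i j : ℚ)).rank) ∧
        r.domain = {x | ∀ i, w i = true → 0 < (M i 0 : ℝ) + ∑ j : Fin k, (M i j.succ : ℝ) * x j} ∧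
        Set.EqOn r.integrand
          (fun x => MvPolynomial.aeval x P / ∏ i, ((M i 0 : ℝ) + ∑ j : Fin k, (M i j.succ : ℝ) * x j) ^ m i)
          r.domain := by
  sorry

/-! ## Glue (sorry-free) -/

/-- **Sector inclusion from S2**: every genus-zero generator is an everywhere-good linear-cell
generator, `GZ ⊆ cell ∅` (the vacuous side condition `q ∉ ∅` is discarded).
[route PeriodConductors; Oxley 2011, Thm. 6.6.3] -/
theorem gzSet_subset_cell
    (h2 : ∀ (k : ℕ) (r : KZ.IntegralRep k) (p : MvPolynomial (Fin k) ℚ) (a : Fin k → Fin k → ℕ) (b c : Fin k → ℕ),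
      r.domain = {t | (∀ i, 0 < t i) ∧ (∀ i, t i < 1) ∧ StrictAnti t} →
      Set.EqOn r.integrand (fun t => MvPolynomial.aeval t p / ((∏ i, t i ^ b i) * (∏ i, (1 - t i) ^ c i) * ∏ i, ∏ j, if i < j then (t i - t j) ^ a i j else 1)) r.domain →
      ∃ (K : ℕ) (M : Fin K → Fin (k + 1) → ℤ) (w : Fin K → Bool) (m : Fin K → ℕ) (P : MvPolynomial (Fin k) ℚ),
        (∃ i, M i = Pi.single 0 1) ∧
        (∀ q : ℕ, q.Prime → ∀ T : Finset (Fin K),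
          (Matrix.of fun (i : T) (j : Fin (k + 1)) => (M i j : ZMod q)).rank =
            (Matrix.of fun (i : T) (j : Fin (k + 1)) => (M i j : ℚ)).rank) ∧
        r.domain = {x | ∀ i, w i = true → 0 < (M i 0 : ℝ) + ∑ j : Fin k, (M i j.succ : ℝ) * x j} ∧
        Set.EqOn r.integrand
          (fun x => MvPolynomial.aeval x P / ∏ i, ((M i 0 : ℝ) + ∑ j : Fin k, (M i j.succ : ℝ) * x j) ^ m i)
          r.domain) :
    gzSet ⊆ cell ∅ := by
  rintro x ⟨k, r, p, a, b, c, hd, hf, rfl⟩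
  obtain ⟨K, M, w, m, P, hrow, hgood, hdom, hint⟩ := h2 k r p a b c hd hf
  exact ⟨k, K, M, w, m, P, r, hrow, fun q hq _ => hgood q hq, hdom, hint, rfl⟩

/-- **Soundness step**: if `eval c = 0` and `c − c₀` is a relation then `eval c₀ = 0`
(every relation evaluates to `0`: `KZ.relations_le_ker_eval_holds`).
[Kontsevich–Zagier 2001, §1.2; Huber–Müller-Stach 2017, §13.1] -/
theorem eval_eq_zero_of_sub_mem_relations {c c₀ : KZ.FormalRep} (hc : KZ.eval c = 0)
    (h : c - c₀ ∈ KZ.relations) : KZ.eval c₀ = 0 := by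
  have hsound : KZ.eval (c - c₀) = 0 :=
    (AddMonoidHom.mem_ker).1 (KZ.relations_le_ker_eval_holds h)
  rwa [map_sub, hc, zero_sub, neg_eq_zero] at hsound

/-! ## The crux -/

set_option linter.defProp false in
/-- **Composition, hypotheses form (pure logic + soundness of the moves).** The two stub STATEMENTS
imply the crux BY NAME: given `eval c = 0`, the residual (S1) gives `c₀` in the `ℤ`-span of
genus-zero classes with `c − c₀ ∈ relations`; the sector inclusion (S2, through `gzSet_subset_cell`
and `AddSubgroup.closure_mono`) puts `c₀` in the `ℤ`-span of everywhere-good linear cells;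
soundness gives `eval c₀ = 0`; so `c' := c₀` witnesses the crux. Declared as a `def` (sorry-free,
axioms propext/Classical.choice/Quot.sound) so that `RamifiedReduction_of` below is the unique
theorem of this file concluding the crux (skeleton audit).
[Kontsevich–Zagier 2001, §1.2 Conj. 1; route PeriodConductors, Assembly] -/
def ramifiedReduction_of_stubs :
    (∀ c : Literature.NumberTheory.Transcendental.KZ.FormalRep, Literature.NumberTheory.Transcendental.KZ.eval c = 0 → ∃ c₀ ∈ AddSubgroup.closure {x : Literature.NumberTheory.Transcendental.KZ.FormalRep | ∃ (k : ℕ) (r : Literature.NumberTheory.Transcendental.KZ.IntegralRep k) (p : MvPolynomial (Fin k) ℚ) (a : Fin k → Fin k → ℕ) (b c : Fin k → ℕ), r.domain = {t | (∀ i, 0 < t i) ∧ (∀ i, t i < 1) ∧ StrictAnti t} ∧ Set.EqOn r.integrand (fun t => MvPolynomial.aeval t p / ((∏ i, t i ^ b i) * (∏ i, (1 - t i) ^ c i) * ∏ i, ∏ j, if i < j then (t i - t j) ^ a i j else 1)) r.domain ∧ x = Literature.NumberTheory.Transcendental.KZ.of r}, c - c₀ ∈ Literature.NumberTheory.Transcendental.KZ.relations)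 →
    (∀ (k : ℕ) (r : KZ.IntegralRep k) (p : MvPolynomial (Fin k) ℚ) (a : Fin k → Fin k → ℕ) (b c : Fin k → ℕ),
      r.domain = {t | (∀ i, 0 < t i) ∧ (∀ i, t i < 1) ∧ StrictAnti t} →
      Set.EqOn r.integrand (fun t => MvPolynomial.aeval t p / ((∏ i, t i ^ b i) * (∏ i, (1 - t i) ^ c i) * ∏ i, ∏ j, if i < j then (t i - t j) ^ a i j else 1)) r.domain →
      ∃ (K : ℕ) (M : Fin K → Fin (k + 1) → ℤ) (w : Fin K → Bool) (m : Fin K → ℕ) (P : MvPolynomial (Fin k) ℚ),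
        (∃ i, M i = Pi.single 0 1) ∧
        (∀ q : ℕ, q.Prime → ∀ T : Finset (Fin K),
          (Matrix.of fun (i : T) (j : Fin (k + 1)) => (M i j : ZMod q)).rank =
            (Matrix.of fun (i : T) (j : Fin (k + 1)) => (M i j : ℚ)).rank) ∧
        r.domain = {x | ∀ i, w i = true → 0 < (M i 0 : ℝ) + ∑ j : Fin k, (M i j.succ : ℝ) * x j} ∧
        Set.EqOn r.integrand
          (fun x => MvPolynomial.aeval x P / ∏ i, ((M i 0 : ℝ) + ∑ j : Fin k, (M i j.succ : ℝ) * x j) ^ m i)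
          r.domain) →
    RamifiedReduction := by
  intro h1 h2
  refine ramifiedReduction_iff.mpr ?_
  intro c hc
  -- S1: reach the genus-zero sector modulo relations
  obtain ⟨c₀, hc₀, hrel⟩ := h1 c hc
  -- S2: the genus-zero sector lies inside the everywhere-good linear sector
  have hc₀' : c₀ ∈ AddSubgroup.closure (cell ∅) :=
    AddSubgroup.closure_mono (gzSet_subset_cell h2) hc₀
  -- soundness: the normal form still vanishes
  exact ⟨c₀, hc₀', eval_eq_zero_of_sub_mem_relations hc hrel, hrel⟩

/-- **Skeleton theorem (registered form).** The crux `RamifiedReduction` BY NAME from the two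
declared stubs, via the sorry-free composition `ramifiedReduction_of_stubs`; `sorry` occurs only
inside `stub_residualBeyondGenusZero` and `stub_genusZeroCellRegular`.
[Kontsevich–Zagier 2001, §1.2 Conj. 1; route PeriodConductors] -/
theorem RamifiedReduction_of : RamifiedReduction :=
  ramifiedReduction_of_stubs stub_residualBeyondGenusZero stub_genusZeroCellRegular

end Summit.KontsevichZagierPeriods.KontsevichZagierPeriods.Cruxes.RamifiedReduction.Birth
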